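import Literature.MathematicalPhysics.QuantumManyBody.PeriodicMaxFormGroundStates
import HarnessLib

/-!
# Coordinate saturation on the torus — stub `stub_coordinateSaturation` of line `third-law-current-floor`,
# crux `BECConjugateDomination.HardCoreExtension` (stmt-AtomisticToContinuum-11786)

**Statement** (`stub_coordinateSaturation`). Let `Z ⊆ (ℝ/ℤ)^{N×3}` be measurable (Haar probability
measure `volume`, the convention of `PeriodicFormDomain.lean`) and suppose that for every coordinate
`q` and a.e. `t` the coordinate circle `s ↦ t + s𝐞_q` lies a.e. inside `Z` or a.e. outside `Z`. Then
`|Z| = 0` or `|Zᶜ| = 0` (ergodicity of the coordinate translations).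

**Proof.** Let `f = 1_Z`. For `n ≠ 0` pick `q` with `n_q ≠ 0`. By invariance of the Haar measure under
`t ↦ t + s𝐞_q`, averaging over `s` and Fubini,
`𝓕f(n) = ∫_t ∫_s e_{-n}(t + s𝐞_q) f(t + s𝐞_q) ds dt = ∫_t e_{-n}(t) (∫_s e_{-n_q}(s) f(t + s𝐞_q) ds) dt`,
and for a.e. `t` the inner integrand is `e_{-n_q}(s)` times an a.e. constant, so the inner integral is
a multiple of `∫ e_{-n_q} = 0`. Hence all non-constant Fourier coefficients of `f` vanish, so `f` agrees
a.e. with the constant `𝓕f(0)` (the characters form a Hilbert basis, `UnitAddTorus.mFourierBasis`,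
through the tree lemma `Lp_eq_of_forall_inner_mFourierLp_eq`), and a `{0,1}`-valued a.e. constant
function on a probability space is a.e. `0` or a.e. `1`.

Tree lemmas used: `Torus.mFourier_apply_add`, `HaarTorus.inner_mFourierLp_eq_mFourierCoeff`,
`Lp_eq_of_forall_inner_mFourierLp_eq`. Mathlib: `integral_add_right_eq_self`,
`integral_integral_swap`, `fourier_add_half_inv_index`, `integral_eq_zero_of_add_right_eq_neg`,
`orthonormal_mFourier`.

References: M. Einsiedler, T. Ward, *Ergodic Theory with a view towards Number Theory* (2011),
Prop. 2.16 / Thm. 4.14 (ergodicity of rotations via Fourier series); Y. Katznelson, *An Introduction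
to Harmonic Analysis* (2004), Ch. I §2 (uniqueness of Fourier coefficients); M. Reed, B. Simon,
*Methods of Modern Mathematical Physics IV* (1978), Thm. XIII.44 (ergodicity in the positivity argument).
-/

noncomputable section

namespace Summit.AtomisticToContinuum.BoseEinsteinCondensation.Cruxes.HardCoreExtension.ThirdLawCurrentFloorAlt

open MeasureTheory Filter UnitAddTorus
open scoped ENNReal NNReal BigOperators Topology InnerProductSpace ComplexConjugate
open Literature.MathematicalPhysics.QuantumManyBody.BoseGas
open Literature.Analysis.FunctionSpaces

attribute [local instance] Literature.MathematicalPhysics.QuantumManyBody.BoseGas.formDomain_measureSpace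
  Literature.MathematicalPhysics.QuantumManyBody.BoseGas.formDomain_isProbabilityMeasure
  Literature.MathematicalPhysics.QuantumManyBody.BoseGas.formDomain_isProbabilityMeasure_pi

/-! ### Characters -/

/-- A non-constant character of `ℝ/ℤ` has integral zero for the Haar probability measure (the
global-`volume` version is in `Literature/NumberTheory/DiophantineApproximation/FloorMultiples`; kept
private here to avoid that import). [folklore] -/
private theorem integral_fourier_of_ne_zero {m : ℤ} (hm : m ≠ 0) :
    ∫ s : UnitAddCircle, fourier m s = 0 := by
  haveI : (volume : Measure UnitAddCircle).IsAddHaarMeasure :=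
    inferInstanceAs (Measure.IsAddHaarMeasure AddCircle.haarAddCircle)
  exact integral_eq_zero_of_add_right_eq_neg (fourier_add_half_inv_index hm one_pos)

/-- A character of `(ℝ/ℤ)^{N×3}` on a coordinate vector: `e_n(s𝐞_q) = e_{n_q}(s)`. [folklore] -/
private theorem mFourier_single_apply {N : ℕ} (n : Fin N × Fin 3 → ℤ) (q : Fin N × Fin 3)
    (s : UnitAddCircle) :
    mFourier n (Pi.single q s : UnitAddTorus (Fin N × Fin 3)) = fourier (n q) s := by
  simp only [mFourier, ContinuousMap.coe_mk]
  rw [Finset.prod_eq_single q]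
  · rw [Pi.single_eq_same]
  · intro i _ hi
    rw [Pi.single_eq_of_ne hi, fourier_eval_zero]
  · intro h
    exact absurd (Finset.mem_univ q) h

/-- A character along a coordinate circle: `e_n(t + s𝐞_q) = e_n(t) e_{n_q}(s)` (a copy of
`Torus.mFourier_add_single` of `Literature/Analysis/FunctionSpaces/TorusAxisAverage`, kept private to
avoid that import). [folklore] -/
private theorem mFourier_add_single {N : ℕ} (n : Fin N × Fin 3 → ℤ) (t : UnitAddTorus (Fin N × Fin 3))
    (q : Fin N × Fin 3) (s : UnitAddCircle) :
    mFourier n (t + Pi.single q s) = mFourier n t * fourier (n q) s := by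
  rw [Torus.mFourier_apply_add, mFourier_single_apply]

/-! ### Vanishing of the non-constant Fourier coefficients of a saturated indicator -/

/-- **Saturation along the `q`-circles kills the Fourier coefficients with `n_q ≠ 0`.** If for a.e. `t`
the circle `s ↦ t + s𝐞_q` lies a.e. in `Z` or a.e. off `Z`, then `𝓕(1_Z)(n) = 0` whenever `n_q ≠ 0`
(translation invariance of the Haar measure, Fubini, `∫ e_{-n_q} = 0`). [folklore] -/
theorem mFourierCoeff_indicator_eq_zero_of_saturated {N : ℕ} {Z : Set (UnitAddTorus (Fin N × Fin 3))}
    (hZ : MeasurableSet Z) {q : Fin N × Fin 3}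
    (hsat : ∀ᵐ t ∂(volume : Measure (UnitAddTorus (Fin N × Fin 3))),
        (∀ᵐ (s : UnitAddCircle) ∂(volume : Measure UnitAddCircle), t + Pi.single q s ∈ Z) ∨
        (∀ᵐ (s : UnitAddCircle) ∂(volume : Measure UnitAddCircle), t + Pi.single q s ∉ Z))
    {n : Fin N × Fin 3 → ℤ} (hn : n q ≠ 0) :
    mFourierCoeff (Z.indicator fun _ => (1 : ℂ)) n = 0 := by
  haveI : (volume : Measure UnitAddCircle).IsAddHaarMeasure :=
    inferInstanceAs (Measure.IsAddHaarMeasure AddCircle.haarAddCircle)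
  haveI : (volume : Measure (UnitAddTorus (Fin N × Fin 3))).IsAddRightInvariant := by
    rw [volume_pi]; infer_instance
  set f : UnitAddTorus (Fin N × Fin 3) → ℂ := Z.indicator fun _ => (1 : ℂ) with hf
  -- the integrand of the Fourier coefficient
  set F : UnitAddTorus (Fin N × Fin 3) → ℂ := fun t => mFourier (-n) t * f t with hF
  have hfm : Measurable f := measurable_const.indicator hZ
  have hFm : Measurable F := (mFourier (-n)).continuous.measurable.mul hfm
  have hFb : ∀ t, ‖F t‖ ≤ 1 := fun t => by
    have h1 : ‖mFourier (-n) t‖ = 1 := by simp [mFourier]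
    have h2 : ‖f t‖ ≤ 1 := by
      rw [hf]
      refine (norm_indicator_le_norm_self _ _).trans ?_
      simp
    calc ‖F t‖ = ‖mFourier (-n) t‖ * ‖f t‖ := norm_mul _ _
      _ ≤ 1 * 1 := by rw [h1]; exact mul_le_mul_of_nonneg_left h2 zero_le_one
      _ = 1 := mul_one 1
  -- the shear `(s, t) ↦ t + s𝐞_q` is measurable
  have hΦ : Measurable fun p : UnitAddCircle × UnitAddTorus (Fin N × Fin 3) =>
      p.2 + Pi.single q p.1 :=
    measurable_snd.add ((measurable_update (0 : UnitAddTorus (Fin N × Fin 3))).comp measurable_fst)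
  -- Step 1: translation invariance and averaging over the circle
  have h1 : ∀ s : UnitAddCircle, ∫ t : UnitAddTorus (Fin N × Fin 3), F (t + Pi.single q s) =
      ∫ t : UnitAddTorus (Fin N × Fin 3), F t := fun s =>
    integral_add_right_eq_self (μ := (volume : Measure (UnitAddTorus (Fin N × Fin 3)))) F
      (Pi.single q s)
  have h2 : ∫ t : UnitAddTorus (Fin N × Fin 3), F t =
      ∫ s : UnitAddCircle, ∫ t : UnitAddTorus (Fin N × Fin 3), F (t + Pi.single q s) := by
    simp_rw [h1]
    rw [integral_const, probReal_univ, one_smul]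
  -- Step 2: Fubini
  have hint : Integrable
      (Function.uncurry fun (s : UnitAddCircle) (t : UnitAddTorus (Fin N × Fin 3)) => F (t + Pi.single q s))
      ((volume : Measure UnitAddCircle).prod volume) := by
    refine Integrable.of_bound (hFm.comp hΦ).aestronglyMeasurable 1 (Eventually.of_forall fun p => ?_)
    exact hFb _
  have h3 : ∫ s : UnitAddCircle, ∫ t : UnitAddTorus (Fin N × Fin 3), F (t + Pi.single q s) =
      ∫ t : UnitAddTorus (Fin N × Fin 3), ∫ s : UnitAddCircle, F (t + Pi.single q s) :=
    integral_integral_swap hint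
  -- Step 3: the inner integral vanishes for a.e. `t`
  have hzero : ∫ s : UnitAddCircle, fourier (-n q) s = 0 :=
    integral_fourier_of_ne_zero (neg_ne_zero.mpr hn)
  have h4 : ∀ᵐ t : UnitAddTorus (Fin N × Fin 3) ∂volume,
      ∫ s : UnitAddCircle, F (t + Pi.single q s) = 0 := by
    filter_upwards [hsat] with t ht
    have key : ∀ s : UnitAddCircle,
        F (t + Pi.single q s) = mFourier (-n) t * fourier (-n q) s * f (t + Pi.single q s) := fun s => by
      simp only [hF, mFourier_add_single, Pi.neg_apply]
    simp_rw [key]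
    rcases ht with h | h
    · have hae : (fun s : UnitAddCircle => mFourier (-n) t * fourier (-n q) s * f (t + Pi.single q s))
          =ᵐ[volume] fun s : UnitAddCircle => mFourier (-n) t * fourier (-n q) s := by
        filter_upwards [h] with s hs
        rw [hf, Set.indicator_of_mem hs, mul_one]
      rw [integral_congr_ae hae, integral_const_mul, hzero, mul_zero]
    · have hae : (fun s : UnitAddCircle => mFourier (-n) t * fourier (-n q) s * f (t + Pi.single q s))
          =ᵐ[volume] fun _ => 0 := by
        filter_upwards [h] with s hs
        rw [hf, Set.indicator_of_notMem hs, mul_zero]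
      rw [integral_congr_ae hae, integral_zero]
  -- conclusion
  calc mFourierCoeff f n = ∫ t : UnitAddTorus (Fin N × Fin 3), F t := rfl
    _ = 0 := by rw [h2, h3, integral_congr_ae h4, integral_zero]

/-! ### From vanishing coefficients to an a.e. constant -/

/-- **Uniqueness of Fourier coefficients**: an `L²` function on `(ℝ/ℤ)^{N×3}` all of whose
non-constant Fourier coefficients vanish agrees a.e. with the constant `𝓕f(0)` (the characters form a
Hilbert basis). [folklore] -/
theorem ae_eq_const_of_mFourierCoeff_eq_zero {N : ℕ} {f : UnitAddTorus (Fin N × Fin 3) → ℂ}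
    (hf : MemLp f 2 (volume : Measure (UnitAddTorus (Fin N × Fin 3))))
    (h : ∀ n : Fin N × Fin 3 → ℤ, n ≠ 0 → mFourierCoeff f n = 0) :
    ∀ᵐ t : UnitAddTorus (Fin N × Fin 3) ∂volume, f t = mFourierCoeff f 0 := by
  set g : Lp ℂ 2 (volume : Measure (UnitAddTorus (Fin N × Fin 3))) := hf.toLp f
  have hg : (g : UnitAddTorus (Fin N × Fin 3) → ℂ) =ᵐ[volume] f := hf.coeFn_toLp
  have hcoeff : ∀ n : Fin N × Fin 3 → ℤ,
      mFourierCoeff (g : UnitAddTorus (Fin N × Fin 3) → ℂ) n = mFourierCoeff f n := fun n =>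
    integral_congr_ae (hg.mono fun t ht => by simp only [ht])
  set c : ℂ := mFourierCoeff f 0
  -- `g` and the constant class `c • e₀` have the same Fourier coefficients
  have heq : g = c • mFourierLp 2 (0 : Fin N × Fin 3 → ℤ) := by
    refine Lp_eq_of_forall_inner_mFourierLp_eq fun n => ?_
    rw [HaarTorus.inner_mFourierLp_eq_mFourierCoeff, hcoeff, inner_smul_right,
      orthonormal_iff_ite.mp (orthonormal_mFourier (d := Fin N × Fin 3)) n 0]
    by_cases hn : n = 0
    · rw [hn, if_pos rfl, mul_one]
    · rw [if_neg hn, mul_zero]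
      exact h n hn
  have h0 : ⇑(mFourierLp 2 (0 : Fin N × Fin 3 → ℤ)) =ᵐ[volume]
      fun _ : UnitAddTorus (Fin N × Fin 3) => (1 : ℂ) := by
    filter_upwards [coeFn_mFourierLp 2 (0 : Fin N × Fin 3 → ℤ)] with t ht
    rw [ht, mFourier_zero, ContinuousMap.one_apply]
  have hsmul : ⇑(c • mFourierLp 2 (0 : Fin N × Fin 3 → ℤ)) =ᵐ[volume]
      fun _ : UnitAddTorus (Fin N × Fin 3) => c := by
    filter_upwards [Lp.coeFn_smul c (mFourierLp 2 (0 : Fin N × Fin 3 → ℤ)), h0] with t h1 h2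
    rw [h1, Pi.smul_apply, h2, smul_eq_mul, mul_one]
  rw [← heq] at hsmul
  filter_upwards [hg, hsmul] with t h1 h2
  rw [← h1, h2]

/-! ### The saturation lemma -/

/-- **SAT `stub_coordinateSaturation`** (a set saturated along a.e. coordinate circle in every direction
is null or conull). For a measurable `Z ⊆ (ℝ/ℤ)^{N×3}` (Haar probability measure) such that for every
coordinate `q` and a.e. `t` the circle `s ↦ t + s𝐞_q` lies a.e. inside `Z` or a.e. outside `Z`:
`|Z| = 0` or `|Zᶜ| = 0`. Proof: for `n ≠ 0` pick `q` with `n_q ≠ 0`; by invariance of the Haar measure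
under `t ↦ t + s𝐞_q` and Fubini, `𝓕(1_Z)(n) = ∫_t e_{-n}(t) ∫_s e_{-n_q}(s) 1_Z(t + s𝐞_q) ds dt = 0`
(the inner integrand is a.e. constant in `s` times `e_{-n_q}`, and `∫ e_{-n_q} = 0`), so `1_Z` equals
the constant `𝓕(1_Z)(0)` a.e. (`mFourierBasis`), and a `{0,1}`-valued a.e. constant on a probability
space is a.e. `0` or a.e. `1`. Degenerate case `N = 0` (one-point torus) included: then every `n` is `0`.
This is the ergodicity step of the positivity argument for ground states.
[cite: ReedSimonIV1978, Thm XIII.44] -/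
theorem stub_coordinateSaturation :
    ∀ (N : ℕ) (Z : Set (UnitAddTorus (Fin N × Fin 3))), MeasurableSet Z →
      (∀ q : Fin N × Fin 3, ∀ᵐ t ∂(volume : Measure (UnitAddTorus (Fin N × Fin 3))),
        (∀ᵐ (s : UnitAddCircle) ∂(volume : Measure UnitAddCircle), t + Pi.single q s ∈ Z) ∨
        (∀ᵐ (s : UnitAddCircle) ∂(volume : Measure UnitAddCircle), t + Pi.single q s ∉ Z)) →
      (volume : Measure (UnitAddTorus (Fin N × Fin 3))) Z = 0 ∨
      (volume : Measure (UnitAddTorus (Fin N × Fin 3))) Zᶜ = 0 := by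
  intro N Z hZ hsat
  set f : UnitAddTorus (Fin N × Fin 3) → ℂ := Z.indicator fun _ => (1 : ℂ) with hf_def
  have hfm : MemLp f 2 (volume : Measure (UnitAddTorus (Fin N × Fin 3))) :=
    memLp_indicator_const 2 hZ (1 : ℂ) (Or.inr (measure_ne_top _ _))
  have hcoef : ∀ n : Fin N × Fin 3 → ℤ, n ≠ 0 → mFourierCoeff f n = 0 := fun n hn => by
    obtain ⟨q, hq⟩ := Function.ne_iff.mp hn
    exact mFourierCoeff_indicator_eq_zero_of_saturated hZ (hsat q) hq
  have hae := ae_eq_const_of_mFourierCoeff_eq_zero hfm hcoef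
  by_cases hZ0 : (volume : Measure (UnitAddTorus (Fin N × Fin 3))) Z = 0
  · exact Or.inl hZ0
  · right
    have hfr : ∃ᵐ t : UnitAddTorus (Fin N × Fin 3) ∂volume, t ∈ Z := frequently_ae_mem_iff.mpr hZ0
    obtain ⟨t, htZ, htc⟩ := (hfr.and_eventually hae).exists
    have hc : mFourierCoeff f 0 = 1 := by rw [← htc, hf_def, Set.indicator_of_mem htZ]
    rw [measure_eq_zero_iff_ae_notMem]
    filter_upwards [hae] with s hs
    rw [Set.mem_compl_iff, not_not]
    by_contra hsZ
    rw [hf_def, Set.indicator_of_notMem hsZ, hc] at hs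
    exact zero_ne_one hs

end Summit.AtomisticToContinuum.BoseEinsteinCondensation.Cruxes.HardCoreExtension.ThirdLawCurrentFloorAlt

end
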